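import Literature.Computability.Cryptography.HallgrenClassGroupIdealCount
import Literature.NumberTheory.LFunctions.GRHPrimeIdealCountLowerBound
import Mathlib.Analysis.Complex.ExponentialBounds
import HarnessLib

/-!
# Hallgren 2005 / class numbers under GRH — step N3c: under ERH the class number of an imaginary
# quadratic field is `≫ √|d_K| / log|d_K|`, with an absolute constant

Topic `Literature/Computability/Cryptography`; proof companion of `HallgrenClassGroup.lean`
(named fact `Hallgren2005_classNumber_qsolvable_of_GRH`). Everything here is PROVED (theorems
only; no definition, no named fact). The only hypothesis is the Riemann hypothesis for `ζ_K`
(`NumberField.ExtendedRiemannHypothesis K`), which the Grand Riemann Hypothesis supplies for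
quadratic `K` (`Hallgren2005.extendedRiemannHypothesis_of_grandRiemannHypothesisGL`,
`HallgrenClassGroupERH.lean`).

**Theorem** (`sqrt_natAbs_discr_le_classNumber_mul_log_of_erh`). There is an explicit absolute
constant `C₁ = 24 C + 100` (`C = grhPsiConst`, the constant of the tree's GRH-conditional Chebyshev
bound) such that for every imaginary quadratic field `K` whose Dedekind zeta function satisfies the
Riemann hypothesis,

  `√|d_K| ≤ C₁ · h_K · log|d_K|`.

This is a weak form (by a factor `log|d_K| · log log|d_K|`) of Littlewood's conditional bound
`L(1, χ_d) ≫ 1/log log|d|` (Littlewood 1928), i.e. `h(−d) ≫ √d/log log d` under GRH, and is all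
the class-number algorithm needs: random forms of discriminant `−d` then escape every proper
subgroup of the class group with probability `≫ 1/polylog(d)` (step N4 of the plan).

**Proof.** Count the non-zero ideals of norm `≤ N = |d_K|²` in two ways. From below, they include
the prime ideals, and under ERH `π_K(N) ≥ N/(2 log N) − (C + 2)(log|d_K| + 2)√N`
(`primeIdealCount_ge_of_erh`, Lagarias–Odlyzko 1977 in the tree's uniform one-sided form). From
above, class by class against lattice points of the reduced forms,
`#{𝔞 ≠ 0 : N𝔞 ≤ N} ≤ ½ h_K (16 N/√|d_K| + 8√N + 1)`
(`Hallgren2005.card_nonzero_ideals_le_classNumber_mul`, Davenport Ch. 6). With `N = |d_K|²`,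
`z = √|d_K|`, `L = log|d_K| ≥ 1`, `L ≤ 2z`, this reads `z⁴/(4L) − (C+2)(L+2)z² ≤ 8h z³ + 4h z² + h/2`,
whence `z ≤ (24C + 98) h L`.

## References

* J. E. Littlewood, *On the class-number of the corpus `P(√−k)`*, Proc. LMS 27 (1928), 358–372
  (the sharp conditional bound; here only a weak form is derived).
* J. C. Lagarias, A. M. Odlyzko, *Effective versions of the Chebotarev density theorem* (1977),
  Thm. 1.1 [LagariasOdlyzko1977].
* H. Davenport, *Multiplicative Number Theory*, GTM 74, Ch. 6 [DavenportMNT1980].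
* A. M. Childs, W. van Dam, Rev. Mod. Phys. 82 (2010), §5.7 ("assuming the GRH") [ChildsVandam2010].
-/

noncomputable section

open Module NumberField Real
open Literature.NumberTheory.EllipticCurves
open Literature.NumberTheory.LFunctions Literature.NumberTheory.LFunctions.NumberField

namespace Literature.Computability.Cryptography.Hallgren2005

variable {K : Type*} [Field K] [NumberField K]

/-- Prime ideals of norm `≤ N` are among the non-zero ideals of norm `≤ N`:
`π_K(N) ≤ #{𝔞 ≠ 0 : N𝔞 ≤ N}`. [folklore] -/
theorem primeIdealCount_le_ncard (N : ℕ) :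
    primeIdealCount K N ≤ Set.ncard {I : Ideal (𝓞 K) | I ≠ ⊥ ∧ Ideal.absNorm I ≤ N} := by
  refine Set.ncard_le_ncard ?_ ((Ideal.finite_setOf_absNorm_le (S := 𝓞 K) N).subset fun I hI => hI.2)
  rintro P ⟨-, hP0, hPN⟩
  exact ⟨hP0, by exact_mod_cast hPN⟩

/-- The final bookkeeping: if `z, h, L ≥ 1`, `L ≤ 2z`, `C > 0` and
`z⁴/(4L) − (C+2)(L+2)z² ≤ 8h z³ + 4h z² + h/2`, then `z ≤ (24C + 100) h L`. [folklore] -/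
theorem sqrt_bookkeeping {z h L C : ℝ} (hz : 1 ≤ z) (hh : 1 ≤ h) (hL : 1 ≤ L) (hLz : L ≤ 2 * z)
    (hC : 0 < C)
    (hmain : z ^ 4 / (4 * L) - (C + 2) * (L + 2) * z ^ 2 ≤ 8 * h * z ^ 3 + 4 * h * z ^ 2 + h / 2) :
    z ≤ (24 * C + 100) * h * L := by
  have hL0 : 0 < L := by linarith
  have hz0 : 0 < z := by linarith
  -- clear the denominator
  have h1 : z ^ 4 ≤ 4 * L * (8 * h * z ^ 3 + 4 * h * z ^ 2 + h / 2 + (C + 2) * (L + 2) * z ^ 2) := by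
    have : z ^ 4 / (4 * L) ≤ 8 * h * z ^ 3 + 4 * h * z ^ 2 + h / 2 + (C + 2) * (L + 2) * z ^ 2 := by
      linarith
    rwa [div_le_iff₀ (by positivity), mul_comm] at this
  -- bound each term by a multiple of `h L z³`
  have hz2 : z ^ 2 ≤ z ^ 3 := by nlinarith
  have hz3 : 1 ≤ z ^ 3 := by nlinarith
  have hhL : 0 ≤ h * L := by positivity
  have t1 : 4 * L * (4 * h * z ^ 2) ≤ 16 * (h * L * z ^ 3) := by nlinarith
  have t2 : 4 * L * (h / 2) ≤ 2 * (h * L * z ^ 3) := by nlinarith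
  have t3 : 4 * L * ((C + 2) * (L + 2) * z ^ 2) ≤ (24 * C + 48) * (h * L * z ^ 3) := by
    -- `(L + 2) ≤ 3L`, `L ≤ 2z`, `1 ≤ h`
    have a1 : (L + 2) * z ^ 2 ≤ 3 * L * z ^ 2 := by nlinarith
    have a2 : L * (3 * L * z ^ 2) ≤ L * (6 * z ^ 3) := by
      refine mul_le_mul_of_nonneg_left ?_ hL0.le
      nlinarith
    have a3 : L * z ^ 3 ≤ h * L * z ^ 3 := by nlinarith [mul_pos hL0 (by positivity : (0 : ℝ) < z ^ 3)]
    have hC2 : 0 ≤ C + 2 := by linarith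
    calc 4 * L * ((C + 2) * (L + 2) * z ^ 2) = 4 * (C + 2) * (L * ((L + 2) * z ^ 2)) := by ring
      _ ≤ 4 * (C + 2) * (L * (3 * L * z ^ 2)) := by gcongr
      _ ≤ 4 * (C + 2) * (L * (6 * z ^ 3)) := by gcongr
      _ = (24 * C + 48) * (L * z ^ 3) := by ring
      _ ≤ (24 * C + 48) * (h * L * z ^ 3) := by
          refine mul_le_mul_of_nonneg_left ?_ (by linarith)
          linarith
  have h2 : z ^ 4 ≤ (24 * C + 98) * (h * L * z ^ 3) := by nlinarith
  have h3 : z * z ^ 3 ≤ ((24 * C + 98) * h * L) * z ^ 3 := by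
    calc z * z ^ 3 = z ^ 4 := by ring
      _ ≤ (24 * C + 98) * (h * L * z ^ 3) := h2
      _ = ((24 * C + 98) * h * L) * z ^ 3 := by ring
  have h4 : z ≤ (24 * C + 98) * h * L := le_of_mul_le_mul_right h3 (by positivity)
  nlinarith

/-- **Under ERH, `√|d_K| ≤ (24C + 100) · h_K · log|d_K|` for every imaginary quadratic field `K`**
(`C = grhPsiConst`, absolute). Lower count: `primeIdealCount_ge_of_erh` at `N = |d_K|²`
(Lagarias–Odlyzko 1977); upper count: `card_nonzero_ideals_le_classNumber_mul` (Davenport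
Ch. 6); then `sqrt_bookkeeping`. A weak form of Littlewood's conditional
`h(−d) ≫ √d / log log d` (Littlewood 1928). [cite: LagariasOdlyzko1977, Thm. 1.1] [cite: DavenportMNT1980, Ch. 6] -/
theorem sqrt_natAbs_discr_le_classNumber_mul_log_of_erh (hK : IsImaginaryQuadratic K)
    (hERH : NumberField.ExtendedRiemannHypothesis K) :
    Real.sqrt ((NumberField.discr K).natAbs : ℝ) ≤
      (24 * grhPsiConst + 100) * NumberField.classNumber K *
        Real.log ((NumberField.discr K).natAbs : ℝ) := by
  have h2 : finrank ℚ K = 2 := hK.1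
  have hd : NumberField.discr K < 0 := hK.discr_neg
  set D : ℕ := (NumberField.discr K).natAbs with hDdef
  -- `3 ≤ |d_K|`
  have hD3 : 3 ≤ D := by
    have h := NumberField.abs_discr_gt_two (K := K) (by rw [h2]; exact one_lt_two)
    have : (D : ℤ) = |NumberField.discr K| := Int.natCast_natAbs _
    omega
  have hDR3 : (3 : ℝ) ≤ D := by exact_mod_cast hD3
  have hDR0 : (0 : ℝ) < D := by linarith
  have hnegd : ((D : ℕ) : ℝ) = -(NumberField.discr K : ℝ) := by
    have : (D : ℤ) = -NumberField.discr K := by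
      rw [hDdef, Int.natCast_natAbs, abs_of_neg hd]
    exact_mod_cast this
  -- the parameters `z = √D`, `L = log D`, `h`, `C`
  set z : ℝ := Real.sqrt D with hz
  set L : ℝ := Real.log D with hL
  set h : ℝ := (NumberField.classNumber K : ℝ) with hh
  set C : ℝ := grhPsiConst with hC
  have hC0 : 0 < C := grhPsiConst_pos
  have hzsq : z ^ 2 = D := Real.sq_sqrt hDR0.le
  have hz1 : 1 ≤ z := by
    rw [hz, show (1 : ℝ) = Real.sqrt 1 from Real.sqrt_one.symm]
    exact Real.sqrt_le_sqrt (by linarith)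
  have hz0 : 0 < z := by linarith
  have hL1 : 1 ≤ L := by
    -- `1 ≤ log 3 ≤ log D` (`e < 3`; cf. `BetaSieve.one_le_log_three` in the sieve files)
    have h3 : (1 : ℝ) ≤ Real.log 3 := by
      rw [Real.le_log_iff_exp_le (by norm_num)]
      have := Real.exp_one_lt_d9
      linarith
    exact h3.trans (Real.log_le_log (by norm_num) hDR3)
  have hLz : L ≤ 2 * z := by
    -- `log D = 2 log √D ≤ 2 (√D − 1)` (cf. `SelbergSymmetry.log_le_two_mul_sqrt`)
    have h := Real.log_le_sub_one_of_pos (Real.sqrt_pos.mpr hDR0)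
    rw [Real.log_sqrt hDR0.le] at h
    rw [hL, hz]
    linarith [Real.sqrt_nonneg (D : ℝ)]
  have hh1 : 1 ≤ h := by
    have := NumberField.classNumber_pos (K := K)
    show (1 : ℝ) ≤ (NumberField.classNumber K : ℝ)
    exact Nat.one_le_cast.mpr this
  -- the lower count under ERH at `x = D²`
  have hx2 : (2 : ℝ) ≤ (D : ℝ) ^ 2 := by nlinarith
  have hgrh := primeIdealCount_ge_of_erh hERH hx2
  rw [Real.log_pow, Real.sqrt_sq hDR0.le, h2] at hgrh
  -- the upper count at `N = D²`
  have hcnt := card_nonzero_ideals_le_classNumber_mul hK (D ^ 2)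
  have hcast : (((D ^ 2 : ℕ) : ℕ) : ℝ) = (D : ℝ) ^ 2 := by push_cast; ring
  rw [hcast, ← hnegd, Real.sqrt_sq hDR0.le] at hcnt
  have hπ : (primeIdealCount K ((D : ℝ) ^ 2) : ℝ) ≤
      (Set.ncard {I : Ideal (𝓞 K) | I ≠ ⊥ ∧ Ideal.absNorm I ≤ D ^ 2} : ℝ) := by
    have := primeIdealCount_le_ncard (K := K) (D ^ 2)
    rw [hcast] at this
    exact_mod_cast this
  -- combine: `D²/(4L) − (C+2)(L+2) D ≤ ½ h (16 D²/z + 8 D + 1)`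
  have hcomb : (D : ℝ) ^ 2 / (2 * (2 * L)) - (C + 2) * (L + 2) * D ≤
      1 / 2 * h * (16 * (D : ℝ) ^ 2 / z + 8 * D + 1) := by
    have e : (C + 2) * (L + (2 : ℕ)) * (D : ℝ) = (C + 2) * (L + 2) * D := by norm_num
    rw [← e]
    exact (hgrh.trans hπ).trans hcnt
  -- rewrite in terms of `z` (`D = z²`) and conclude
  rw [← hzsq] at hcomb
  have hmain : z ^ 4 / (4 * L) - (C + 2) * (L + 2) * z ^ 2 ≤
      8 * h * z ^ 3 + 4 * h * z ^ 2 + h / 2 := by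
    have e1 : (z ^ 2) ^ 2 / (2 * (2 * L)) = z ^ 4 / (4 * L) := by ring
    have e2 : 1 / 2 * h * (16 * (z ^ 2) ^ 2 / z + 8 * z ^ 2 + 1) =
        8 * h * z ^ 3 + 4 * h * z ^ 2 + h / 2 := by
      field_simp
      ring
    rw [e1, e2] at hcomb
    exact hcomb
  exact sqrt_bookkeeping hz1 hh1 hL1 hLz hC0 hmain

end Literature.Computability.Cryptography.Hallgren2005

end
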